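/- Copyright: the b2b-balaban cell (near-miss cell 7), T⁴-continuum fan-out; row NE7b ROUND-2 swarm, seat t4-ne7b-formalise-leaf-05
(row S6e part 3 of `t4/b2b-balaban-t4-ne7b-p1/LEAVES-NE7b.md`, ruling R-OWNER-22-11).  Released under the licence of the project. -/
import Summits.QuantumFields.BalabanUV.T4Continuum.Support.HistoryZoneSurchargeTagged
import Summits.QuantumFields.BalabanUV.T4Continuum.Support.CountThresholdShapeFree

/-!
# Row NE7b, leaf S6e part 3: the zone-surcharge exits over the SHAPE-FREE infrared threshold

Summits-side support leaf of the T⁴-continuum cell (rung (B)+1 on a FINITE torus only; NOT infinite volume, NOT the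
mass gap, NOT the Clay statement; NOT a proof of the spine estimate NE7b).  RULING R-OWNER-22-11: in the T⁴ quantifier
order the infrared threshold is chosen BEFORE the histories' tag types, so every exit's smallness binder must be over a
threshold free of the shape map `sh`; the owner's `CountThresholdShapeFree.irThresholdH C L r β₀ D` and
`relWeightBound_lateMergers_of_irThresholdH` provide it for the TH exit.  THIS LEAF re-bases row S6e's three exits on it:
the named thresholds **`irThresholdGH C θ L r β₀ D`** `:= irThresholdH (lowerA C (a∕2)) … ⊔ 1 ⊔ 2θ(1+β₀)²∕(a·A₀²)` and
**`irThresholdZH C Kz p σ ε θ L r β₀ D`** `:= irThresholdGH C (zoneRate …) … D` (constants, rate and horizon ONLY), and the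
exits **`relWeightBound_lateMergersG_of_irThresholdH`** (class-linear binder `hlabGTH`, every `D`),
**`relWeightBound_lateMergersZS_of_irThresholdH`** (zone binder on the TAGGED tree, `BirthShapeNodup` displayed, every `D`),
**`relWeightBound_lateMergersZS0_of_irThresholdH`** (its horizon-`0` socket dress) and
**`relWeightBound_lateMergersZ_of_irThresholdH`** (v1's flat form on `gmap sh G′`, `InjOn sh events`, horizon `0` — the
binder list of `HistorySocketZTH`'s END) — each = its `HistoryZoneSurcharge`∕`…Tagged` namesake TOKEN FOR TOKEN except
the ONE binder `hir`.  Proofs: §2's member map verbatim over the shape-free TH exit; §3 by the pointwise price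
reductions `priceZS_le_priceG` ∕ `priceZ_le_priceG` (the bodies of the landed Z∕ZS proofs, stated once).  [folklore]
bookkeeping over the lineage's OWN carrier; nothing printed asserted, no `[cite:]`, no `def … : Prop` fact (c1);
constants SYMBOLIC (c2∕c6).  Nothing of H3 ∕ (B) ∕ BetaPertH.  NE7b NOT proved.  HONEST DEPENDENCY (cell): continuum YM on
T⁴ ⇐ BetaPertH ∧ nine spine estimates (0/9 proved); BetaPertH ⇐ (D1) ∧ (D4) ∧ CAP+tail; G-an2-4 gates asym, D1 and NE2/3/4.
-/

open Finset
open Literature.MathematicalPhysics.QuantumFieldTheory.Balaban1983to89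
open T4PersistenceDictionary T4PersistentHistoryCount T4BankedInduction T4PrintedShapeBanking T4PartnerMultiplicity
open T4WeightBudget T4GlobalDenominator T4LiveClassFibration T4LiveStructureGas T4LiveGasToTerms T4RecordPriceSeam
open T4BranchingRecordsGas T4TaggedShapeBanking T4CanonicalMenus T4CountHorizon T4MatchingClosureSocket
open Summit.QuantumFields.BalabanUV.T4Continuum
open PlacementBatch PlacementSkeleton PartnerMultiplicityF PartnerMultiplicityG PartnerMultiplicityZ
open PartnerMultiplicityFloor PartnerMultiplicityThreshold Crowding CountThresholdUniform CountThresholdExit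
open LateMergers ZoneSkeleton HistoryConsistent HistoryZones HistoryZoneSurcharge HistoryCrowdingTagged
open CountThresholdShapeFree HistoryZoneSurchargeTagged

namespace Summit.QuantumFields.BalabanUV.T4Continuum.HistoryZoneSurchargeShapeFree

noncomputable section

/-! ## §1 The shape-free thresholds -/

/-- **THE CLASS-LINEAR THRESHOLD, SHAPE FREE**: the owner's `irThresholdH` at HALF the quadratic constant, enlarged to
`≥ 1` and `≥ 2θ(1+β₀)²∕(a·A₀²)`.  A function of `(C, θ, L, r, β₀, D)` only. [folklore] -/
def irThresholdGH (C : T4PrintedShapeBanking.Consts) (θ : ℝ) (L r : ℕ) (β₀ : ℝ) (D : ℕ) : ℝ :=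
  max (irThresholdH (lowerA C (C.a / 2)) L r β₀ D) (max 1 (2 * θ * (1 + β₀) ^ 2 / (C.a * C.A₀ ^ 2)))

/-- **THE ZONE THRESHOLD, SHAPE FREE**: the class-linear one at the zone rate. [folklore] -/
def irThresholdZH (C : T4PrintedShapeBanking.Consts) (Kz p σ ε θ : ℝ) (L r : ℕ) (β₀ : ℝ) (D : ℕ) : ℝ :=
  irThresholdGH C (zoneRate Kz p σ ε θ) L r β₀ D

/-- the class-linear threshold dominates the half-constant one [folklore] -/
theorem irThresholdH_le_irThresholdGH (C : T4PrintedShapeBanking.Consts) (θ : ℝ) (L r : ℕ) (β₀ : ℝ) (D : ℕ) :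
    irThresholdH (lowerA C (C.a / 2)) L r β₀ D ≤ irThresholdGH C θ L r β₀ D := le_max_left _ _

/-- it is at least `1` [folklore] -/
theorem one_le_irThresholdGH (C : T4PrintedShapeBanking.Consts) (θ : ℝ) (L r : ℕ) (β₀ : ℝ) (D : ℕ) :
    1 ≤ irThresholdGH C θ L r β₀ D := (le_max_left _ _).trans (le_max_right _ _)

/-- it dominates the half-room ratio [folklore] -/
theorem room_le_irThresholdGH (C : T4PrintedShapeBanking.Consts) (θ : ℝ) (L r : ℕ) (β₀ : ℝ) (D : ℕ) :
    2 * θ * (1 + β₀) ^ 2 / (C.a * C.A₀ ^ 2) ≤ irThresholdGH C θ L r β₀ D := (le_max_right _ _).trans (le_max_right _ _)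

/-! ## §2 The class-linear exit over the shape-free threshold -/

section EndToEnd

variable {ε : Type*} [DecidableEq ε]
variable {γ κ ι : Type*} [DecidableEq γ] [DecidableEq κ] {l₀ : ℝ} {K₀ : ℕ} {π : ℕ → ι → κ} {T : ℕ → Finset ι}
  {A A' : ℕ → ℝ → ι → ℝ} {Bad' : ℕ → ℝ → Finset κ} {dead dead' : ℕ → ℝ → ι → ℝ} {F Rf F' Rf' : ℕ → κ → ℝ}
  {nlow nup mlow mup : ℕ → ℝ → ℝ} {Cn : ℝ}

/-- **THE TH EXIT WITH THE CLASS-LINEAR BINDER `hlabGTH`, SHAPE-FREE THRESHOLD.**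
`HistoryZoneSurcharge.relWeightBound_lateMergersG_of_irThreshold` TOKEN FOR TOKEN except `hir` over `irThresholdGH C θ L r β₀ D`;
proof = its member map (TH exit at `lowerA C (a∕2)`, floor `θ∕P² ≤ a∕2`) over
`CountThresholdShapeFree.relWeightBound_lateMergers_of_irThresholdH`. [folklore] -/
theorem relWeightBound_lateMergersG_of_irThresholdH (sh : ε → PEv) {C : T4PrintedShapeBanking.Consts} {L r : ℕ}
    {β₀ : ℝ} (h : ThresholdOK C L r β₀) (hμ₀ : 0 < C.μ) {θ : ℝ} (hθ : 0 ≤ θ)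
    (Cell : ℕ → ℕ → Finset γ) {V Λ : ℝ} (hV : 0 ≤ V) (hΛ : 0 < Λ)
    (hcell : ∀ K a, ((Cell K a).card : ℝ) ≤ V * Λ ^ a) (Dcap Ncap : ℕ → ℕ)
    (jstar : ℕ → ℕ) (hj : ∀ K, jstar K ≤ K) {c : ℝ} (hc : 0 < c)
    (hfrac : ∀ K : ℕ, c * K ≤ ((K - jstar K : ℕ) : ℝ)) (D : ℕ) {Δ : ℝ} (hΔ : 1 ≤ Δ)
    (hA : Regeneration l₀ π T A Bad' dead F Rf nlow nup Cn K₀)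
    (hA' : Regeneration l₀ π T A' Bad' dead' F' Rf' mlow mup Cn K₀) (hCn : 0 ≤ Cn)
    (R : ℕ → ℕ → ℕ) (g : ℕ → ℕ → ℝ) (β' : ℕ → ℝ)
    (h27 : ∀ K, K₀ ≤ K → B14.FlowIneq27 (g K) (β' K) β₀ C.p₀ K)
    (h29 : ∀ K, K₀ ≤ K → B14FlowStep.FlowIneq29 (R K) (g K) L (β' K) β₀ K)
    (hR : ∀ K, K₀ ≤ K → ∀ s, s ≤ K → B14.IsRj L r (g K s) (R K s))
    (hx1 : ∀ K, K₀ ≤ K → ∀ s, s ≤ K → 1 ≤ Real.log ((g K s) ^ 2)⁻¹)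
    (hir : ∀ K, K₀ ≤ K → irThresholdGH C θ L r β₀ D ≤ Real.log ((g K K) ^ 2)⁻¹)
    (hP : ∀ K s, 0 ≤ p0Profile C.A₀ C.p₀ (g K s))
    {ηplus : ℝ} (hηplus : 0 ≤ ηplus) (hr : Λ * Real.exp (ηplus - C.κ₁) < 1)
    {Λ' : ℝ} (hΛ0 : 0 ≤ Λ') (h1 : Λ' * Real.exp (-C.κ₁) * Real.exp ηplus < 1)
    (hx : (Real.exp (-C.E₀) + Real.exp (-C.E₀) * birthMass C *
          (Λ' * Real.exp (-C.κ₁) / (1 - Λ' * Real.exp (-C.κ₁) * Real.exp ηplus))) * Real.exp ηplus ≤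
        Real.exp ηplus - 1)
    (y : ℕ → ℕ → γ → Gen PEv → ℝ)
    (hy0 : ∀ K, ∀ j ≤ K, ∀ z ∈ Cell K (K - j), ∀ G ∈ canonFam Dcap Ncap K j, 0 ≤ y K j z G)
    (hlabGTH : ∀ K, K₀ ≤ K → ∀ j ≤ K, ∀ z ∈ Cell K (K - j), ∀ G ∈ canonFam Dcap Ncap K j,
      y K j z G ≤ 0 ∨ ∃ G' : Gen ε, ConsistentTH sh C K (R K) D G' ∧ FreshT G' ∧
        K - D < G'.reach (dictWT sh (R K) C.n₁) ∧ relabel (shape ∘ sh) G' = G ∧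
        y K j z G ≤ Δ * (Real.exp (θ * ∑ b ∈ births G', ((((sh b).fat : ℕ) : ℝ) + 1)) *
          (Λ' ^ partnerAges (PEv.step ∘ sh) G' * (Real.exp (-credits (credit C (g K) ∘ sh) G') *
            Real.exp (lifeCost (padW (dictWT sh (R K) C.n₁) D) (costT sh C K (R K)) G')))))
    (str : ℕ → κ → Finset (BSlot γ PEv))
    (hinj : ∀ K t, |t| ≤ l₀ → K₀ ≤ K → Set.InjOn (str K) (Bad' K t))
    (hstr : ∀ K t, |t| ≤ l₀ → K₀ ≤ K → ∀ c ∈ Bad' K t,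
      str K c ⊆ bliveSlots Cell (canonFam Dcap Ncap) K ∧
        ∃ o ∈ boldSlots Cell (canonFam Dcap Ncap) jstar K, o ∈ str K c)
    (hF : ∀ K t, |t| ≤ l₀ → K₀ ≤ K → ∀ c ∈ Bad' K t, F K c * Rf K c ≤ famWeight (bslotPrice (y K)) (str K c))
    (hF' : ∀ K t, |t| ≤ l₀ → K₀ ≤ K → ∀ c ∈ Bad' K t, F' K c * Rf' K c ≤ famWeight (bslotPrice (y K)) (str K c)) :
    ∃ K₁, K₀ ≤ K₁ ∧ RelWeightBound l₀ T A A' (fun K t => if K₁ ≤ K then badOfClass π T Bad' K t else ∅)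
      (Set.indicator {K | K₁ ≤ K}
        (fun K => Cn * recordsBudget (Δ * Real.exp (C.κ₁ * (D : ℝ)) * birthMass C) C.κ₁ V Λ ηplus jstar K)) := by
  -- the TH exit at HALF the quadratic constant, with its NAMED threshold
  set C' := lowerA C (C.a / 2) with hC'def
  have h' : ThresholdOK C' L r β₀ := thresholdOK_half h
  have ha : 0 < C.a := h.a_pos
  have hA₀ : 0 < C.A₀ := h.A₀_pos
  have hβ : 0 ≤ β₀ := h.β₀_nonneg
  have hp1 : 1 ≤ C.p₀ := by
    have : r * (C.q' + 1) < C.p₀ := h.rq_lt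
    omega
  have hir' : ∀ K, K₀ ≤ K → irThresholdH C' L r β₀ D ≤ Real.log ((g K K) ^ 2)⁻¹ := fun K hK =>
    (irThresholdH_le_irThresholdGH C θ L r β₀ D).trans (hir K hK)
  have hlabTH : ∀ K, K₀ ≤ K → ∀ j ≤ K, ∀ z ∈ Cell K (K - j), ∀ G ∈ canonFam Dcap Ncap K j,
      y K j z G ≤ 0 ∨ ∃ G' : Gen ε, ConsistentTH sh C' K (R K) D G' ∧ FreshT G' ∧
        K - D < G'.reach (dictWT sh (R K) C'.n₁) ∧ relabel (shape ∘ sh) G' = G ∧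
        y K j z G ≤ Δ * (Λ' ^ partnerAges (PEv.step ∘ sh) G' * (Real.exp (-credits (credit C' (g K) ∘ sh) G') *
          Real.exp (lifeCost (padW (dictWT sh (R K) C'.n₁) D) (costT sh C' K (R K)) G'))) := by
    intro K hK j hjK z hz G hG
    rcases hlabGTH K hK j hjK z hz G hG with h0 | ⟨G', hcG, hfG, hKr, hsh, hy⟩
    · exact Or.inl h0
    · refine Or.inr ⟨G', (consistentTH_lowerA_iff sh C (C.a / 2) K (R K) D G').2 hcG, hfG, hKr, hsh, hy.trans ?_⟩
      -- the infrared floor at this cutoff and the half-room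
      have hxK1 : 1 ≤ Real.log ((g K K) ^ 2)⁻¹ := (one_le_irThresholdGH C θ L r β₀ D).trans (hir K hK)
      have hxK2 : 2 * θ * (1 + β₀) ^ 2 / (C.a * C.A₀ ^ 2) ≤ Real.log ((g K K) ^ 2)⁻¹ :=
        (room_le_irThresholdGH C θ L r β₀ D).trans (hir K hK)
      obtain ⟨hPpos, hroom⟩ := half_room_of_threshold ha hA₀ hβ hp1 hxK1 hxK2
      set P := C.A₀ * Real.log ((g K K) ^ 2)⁻¹ ^ C.p₀ / (1 + β₀) with hPdef
      have hPe : ∀ e ∈ G'.events, (sh e).kind = 0 → P ≤ p0Profile C.A₀ C.p₀ (g K (sh e).step) :=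
        fun e he _ => by
          have hfl := floor_of_ir (h27 K hK) hβ hA₀.le (by linarith) (step_le_of_consistentTH hcG e he)
          simpa [p0Profile, hPdef] using hfl
      have key := exp_mul_fatSumT_mul_exp_neg_credits_le_floor (sh := sh) (g := g K) hθ hPpos hcG hPe
      -- antitonicity: lowering by `θ∕P² ≤ a∕2` leaves at least the credits of `C'`
      have hanti : Real.exp (-credits (credit (lowerA C (θ / P ^ 2)) (g K) ∘ sh) G') ≤
          Real.exp (-credits (credit C' (g K) ∘ sh) G') := by
        rw [Real.exp_le_exp, neg_le_neg_iff, hC'def]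
        exact creditsT_lowerA_anti (sh := sh) C (g K) hroom G'
      have hΔ0 : 0 ≤ Δ := zero_le_one.trans hΔ
      have hcost : lifeCost (padW (dictWT sh (R K) C.n₁) D) (costT sh C K (R K)) G' =
          lifeCost (padW (dictWT sh (R K) C'.n₁) D) (costT sh C' K (R K)) G' := by
        rw [hC'def, costT_lowerA, lowerA_n₁]
      rw [hcost]
      set Xl := Real.exp (lifeCost (padW (dictWT sh (R K) C'.n₁) D) (costT sh C' K (R K)) G')
      set Fb := ∑ b ∈ births G', ((((sh b).fat : ℕ) : ℝ) + 1)
      have hmid := key.trans hanti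
      calc Δ * (Real.exp (θ * Fb) * (Λ' ^ partnerAges (PEv.step ∘ sh) G' *
              (Real.exp (-credits (credit C (g K) ∘ sh) G') * Xl)))
          = Δ * (Λ' ^ partnerAges (PEv.step ∘ sh) G' *
              ((Real.exp (θ * Fb) * Real.exp (-credits (credit C (g K) ∘ sh) G')) * Xl)) := by ring
        _ ≤ Δ * (Λ' ^ partnerAges (PEv.step ∘ sh) G' * (Real.exp (-credits (credit C' (g K) ∘ sh) G') * Xl)) := by
            gcongr
  exact relWeightBound_lateMergers_of_irThresholdH sh h' hμ₀ Cell hV hΛ hcell Dcap Ncap jstar hj hc hfrac D hΔ hA hA'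
    hCn R g β' h27 h29 hR hx1 hir' hP hηplus hr hΛ0 h1 hx y hy0 hlabTH str hinj hstr hF hF'

/-! ## §3 The zone exits over the shape-free threshold -/

/-- **POINTWISE PRICE REDUCTION, TAGGED**: for a consistent, fresh, birth-shape-generic tagged genealogy the zone price
(multiplicity read on the tagged tree) is below the class-linear price at rate `zoneRate`, placement rate `Λ′e^{ε}` — the
body of `relWeightBound_lateMergersZS_of_irThreshold`'s proof, stated once. [folklore] -/
theorem priceZS_le_priceG (sh : ε → PEv) {C : T4PrintedShapeBanking.Consts} {Kz p σ ε' θ : ℝ} (hKz : 1 ≤ Kz)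
    (hp : 0 ≤ p) (h0 : 0 < σ) (h1σ : σ < 1) (hε : 0 < ε') (hθ : 0 < θ) {Λ' Δ : ℝ} (hΛ0 : 0 ≤ Λ') (hΔ0 : 0 ≤ Δ)
    {K : ℕ} {R : ℕ → ℕ} {D : ℕ} (g : ℕ → ℝ) {G' : Gen ε} (hcG : ConsistentTH sh C K R D G') (hfG : FreshT G')
    (hinjB : Set.InjOn sh ↑(births G')) :
    Δ * (Kz ^ (merges G').card * (∏ e ∈ merges G', Crowding.Q (wcntS sh G') σ (sh e).step ^ p) *
        Λ' ^ partnerAges (PEv.step ∘ sh) G' * (Real.exp (-credits (credit C g ∘ sh) G') *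
          Real.exp (lifeCost (padW (dictWT sh R C.n₁) D) (costT sh C K R) G'))) ≤
      Δ * (Real.exp (zoneRate Kz p σ ε' θ * ∑ b ∈ births G', ((((sh b).fat : ℕ) : ℝ) + 1)) *
        ((Λ' * Real.exp ε') ^ partnerAges (PEv.step ∘ sh) G' * (Real.exp (-credits (credit C g ∘ sh) G') *
          Real.exp (lifeCost (padW (dictWT sh R C.n₁) D) (costT sh C K R) G')))) := by
  have key := zone_surchargeS_le (sh := sh) (W := padW (dictWT sh R C.n₁) D) hKz hp h0 h1σ hε hθ hΛ0
    (ConsistentTH.wf_padW hcG hfG) (stepsOK_of_consistentTH hcG) (ordered_of_consistentTH hcG)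
    (kind_eq_zero_of_mem_birthsTH hcG) hinjB
  set Xr := Real.exp (-credits (credit C g ∘ sh) G') * Real.exp (lifeCost (padW (dictWT sh R C.n₁) D) (costT sh C K R) G')
  set M := Kz ^ (merges G').card * (∏ e ∈ merges G', Crowding.Q (wcntS sh G') σ (sh e).step ^ p)
  have hX : 0 ≤ Xr := by positivity
  calc Δ * (M * Λ' ^ partnerAges (PEv.step ∘ sh) G' * Xr)
      = Δ * ((M * Λ' ^ partnerAges (PEv.step ∘ sh) G') * Xr) := by ring
    _ ≤ Δ * ((Real.exp (zoneRate Kz p σ ε' θ * ∑ b ∈ births G', ((((sh b).fat : ℕ) : ℝ) + 1)) *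
          (Λ' * Real.exp ε') ^ partnerAges (PEv.step ∘ sh) G') * Xr) := by gcongr
    _ = _ := by ring

/-- **POINTWISE PRICE REDUCTION, FLAT** (v1's form): for a consistent, fresh tagged genealogy with shape-generic events
the zone price read on `gmap sh G′` is below the class-linear price — the body of
`relWeightBound_lateMergersZ_of_irThreshold`'s proof, stated once. [folklore] -/
theorem priceZ_le_priceG (sh : ε → PEv) {C : T4PrintedShapeBanking.Consts} {Kz p σ ε' θ : ℝ} (hKz : 1 ≤ Kz)
    (hp : 0 ≤ p) (h0 : 0 < σ) (h1σ : σ < 1) (hε : 0 < ε') (hθ : 0 < θ) {Λ' Δ : ℝ} (hΛ0 : 0 ≤ Λ') (hΔ0 : 0 ≤ Δ)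
    {K : ℕ} {R : ℕ → ℕ} {G' : Gen ε} (hcT : ConsistentT sh C K R G') (hfG : FreshT G')
    (hinjG : Set.InjOn sh ↑G'.events) (Xr : ℝ) (hX : 0 ≤ Xr) :
    Δ * (Kz ^ (merges (gmap sh G')).card * (∏ e ∈ merges (gmap sh G'), Crowding.Q (wcnt (gmap sh G')) σ e.step ^ p) *
        Λ' ^ partnerAges PEv.step (gmap sh G') * Xr) ≤
      Δ * (Real.exp (zoneRate Kz p σ ε' θ * ∑ b ∈ births G', ((((sh b).fat : ℕ) : ℝ) + 1)) *
        ((Λ' * Real.exp ε') ^ partnerAges (PEv.step ∘ sh) G' * Xr)) := by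
  have hθz : 0 ≤ zoneRate Kz p σ ε' θ := zoneRate_nonneg hKz hp h0 h1σ hθ.le
  have hcF : Consistent C K R (gmap sh G') := by
    rw [← relabel_eq_gmap]; exact (consistent_relabel_iff sh C K R G').2 hcT
  have hWF : (gmap sh G').WF (dictW R C.n₁) := by
    rw [← relabel_eq_gmap]; exact wf_relabel_of_injOn sh (dictW R C.n₁) (wf_of_consistentT_freshT hcT hfG) hinjG
  have key := zone_surcharge_le (dictW R C.n₁) hKz hp h0 h1σ hε hθ hΛ0 hcF hWF
  have hF : ∑ b ∈ births (gmap sh G'), ((b.fat : ℝ) + 1) ≤ ∑ b ∈ births G', ((((sh b).fat : ℕ) : ℝ) + 1) := by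
    rw [births_gmap]; exact sum_image_le_of_nonneg fun _ _ => by positivity
  have hages : partnerAges PEv.step (gmap sh G') = partnerAges (PEv.step ∘ sh) G' := by
    rw [← relabel_eq_gmap]; exact partnerAges_relabel sh (fun _ => rfl) G'
  have hexp : Real.exp (zoneRate Kz p σ ε' θ * ∑ b ∈ births (gmap sh G'), ((b.fat : ℝ) + 1)) ≤
      Real.exp (zoneRate Kz p σ ε' θ * ∑ b ∈ births G', ((((sh b).fat : ℕ) : ℝ) + 1)) :=
    Real.exp_le_exp.2 (mul_le_mul_of_nonneg_left hF hθz)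
  have hΛp : 0 ≤ (Λ' * Real.exp ε') ^ partnerAges (PEv.step ∘ sh) G' := pow_nonneg (by positivity) _
  rw [hages] at key ⊢
  set M := Kz ^ (merges (gmap sh G')).card * (∏ e ∈ merges (gmap sh G'), Crowding.Q (wcnt (gmap sh G')) σ e.step ^ p)
  have hM := key.trans (mul_le_mul_of_nonneg_right hexp hΛp)
  calc Δ * (M * Λ' ^ partnerAges (PEv.step ∘ sh) G' * Xr)
      = Δ * ((M * Λ' ^ partnerAges (PEv.step ∘ sh) G') * Xr) := by ring
    _ ≤ Δ * ((Real.exp (zoneRate Kz p σ ε' θ * ∑ b ∈ births G', ((((sh b).fat : ℕ) : ℝ) + 1)) *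
          (Λ' * Real.exp ε') ^ partnerAges (PEv.step ∘ sh) G') * Xr) := by gcongr
    _ = _ := by ring

/-- **THE TH EXIT WITH THE ZONE BINDER ON THE TAGGED TREE (`hlabZS`), SHAPE-FREE THRESHOLD, EVERY HORIZON.**
`HistoryZoneSurchargeTagged.relWeightBound_lateMergersZS_of_irThreshold` TOKEN FOR TOKEN except `hir` over
`irThresholdZH C Kz p σ ε θ L r β₀ D`. [folklore] -/
theorem relWeightBound_lateMergersZS_of_irThresholdH (sh : ε → PEv) {C : T4PrintedShapeBanking.Consts} {L r : ℕ}
    {β₀ : ℝ} (h : ThresholdOK C L r β₀) (hμ₀ : 0 < C.μ)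
    {Kz p σ ε' θ : ℝ} (hKz : 1 ≤ Kz) (hp : 0 ≤ p) (h0 : 0 < σ) (h1σ : σ < 1) (hε : 0 < ε') (hθ : 0 < θ)
    (Cell : ℕ → ℕ → Finset γ) {V Λ : ℝ} (hV : 0 ≤ V) (hΛ : 0 < Λ)
    (hcell : ∀ K a, ((Cell K a).card : ℝ) ≤ V * Λ ^ a) (Dcap Ncap : ℕ → ℕ)
    (jstar : ℕ → ℕ) (hj : ∀ K, jstar K ≤ K) {c : ℝ} (hc : 0 < c)
    (hfrac : ∀ K : ℕ, c * K ≤ ((K - jstar K : ℕ) : ℝ)) (D : ℕ) {Δ : ℝ} (hΔ : 1 ≤ Δ)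
    (hA : Regeneration l₀ π T A Bad' dead F Rf nlow nup Cn K₀)
    (hA' : Regeneration l₀ π T A' Bad' dead' F' Rf' mlow mup Cn K₀) (hCn : 0 ≤ Cn)
    (R : ℕ → ℕ → ℕ) (g : ℕ → ℕ → ℝ) (β' : ℕ → ℝ)
    (h27 : ∀ K, K₀ ≤ K → B14.FlowIneq27 (g K) (β' K) β₀ C.p₀ K)
    (h29 : ∀ K, K₀ ≤ K → B14FlowStep.FlowIneq29 (R K) (g K) L (β' K) β₀ K)
    (hR : ∀ K, K₀ ≤ K → ∀ s, s ≤ K → B14.IsRj L r (g K s) (R K s))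
    (hx1 : ∀ K, K₀ ≤ K → ∀ s, s ≤ K → 1 ≤ Real.log ((g K s) ^ 2)⁻¹)
    (hir : ∀ K, K₀ ≤ K → irThresholdZH C Kz p σ ε' θ L r β₀ D ≤ Real.log ((g K K) ^ 2)⁻¹)
    (hP : ∀ K s, 0 ≤ p0Profile C.A₀ C.p₀ (g K s))
    {ηplus : ℝ} (hηplus : 0 ≤ ηplus) (hr : Λ * Real.exp (ηplus - C.κ₁) < 1)
    {Λ' : ℝ} (hΛ0 : 0 ≤ Λ') (h1 : Λ' * Real.exp ε' * Real.exp (-C.κ₁) * Real.exp ηplus < 1)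
    (hx : (Real.exp (-C.E₀) + Real.exp (-C.E₀) * birthMass C *
          (Λ' * Real.exp ε' * Real.exp (-C.κ₁) / (1 - Λ' * Real.exp ε' * Real.exp (-C.κ₁) * Real.exp ηplus))) *
          Real.exp ηplus ≤
        Real.exp ηplus - 1)
    (y : ℕ → ℕ → γ → Gen PEv → ℝ)
    (hy0 : ∀ K, ∀ j ≤ K, ∀ z ∈ Cell K (K - j), ∀ G ∈ canonFam Dcap Ncap K j, 0 ≤ y K j z G)
    (hlabZS : ∀ K, K₀ ≤ K → ∀ j ≤ K, ∀ z ∈ Cell K (K - j), ∀ G ∈ canonFam Dcap Ncap K j,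
      y K j z G ≤ 0 ∨ ∃ G' : Gen ε, ConsistentTH sh C K (R K) D G' ∧ FreshT G' ∧ Set.InjOn sh ↑(births G') ∧
        K - D < G'.reach (dictWT sh (R K) C.n₁) ∧ relabel (shape ∘ sh) G' = G ∧
        y K j z G ≤ Δ * (Kz ^ (merges G').card *
          (∏ e ∈ merges G', Crowding.Q (wcntS sh G') σ (sh e).step ^ p) *
          Λ' ^ partnerAges (PEv.step ∘ sh) G' * (Real.exp (-credits (credit C (g K) ∘ sh) G') *
            Real.exp (lifeCost (padW (dictWT sh (R K) C.n₁) D) (costT sh C K (R K)) G'))))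
    (str : ℕ → κ → Finset (BSlot γ PEv))
    (hinj : ∀ K t, |t| ≤ l₀ → K₀ ≤ K → Set.InjOn (str K) (Bad' K t))
    (hstr : ∀ K t, |t| ≤ l₀ → K₀ ≤ K → ∀ c ∈ Bad' K t,
      str K c ⊆ bliveSlots Cell (canonFam Dcap Ncap) K ∧
        ∃ o ∈ boldSlots Cell (canonFam Dcap Ncap) jstar K, o ∈ str K c)
    (hF : ∀ K t, |t| ≤ l₀ → K₀ ≤ K → ∀ c ∈ Bad' K t, F K c * Rf K c ≤ famWeight (bslotPrice (y K)) (str K c))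
    (hF' : ∀ K t, |t| ≤ l₀ → K₀ ≤ K → ∀ c ∈ Bad' K t, F' K c * Rf' K c ≤ famWeight (bslotPrice (y K)) (str K c)) :
    ∃ K₁, K₀ ≤ K₁ ∧ RelWeightBound l₀ T A A' (fun K t => if K₁ ≤ K then badOfClass π T Bad' K t else ∅)
      (Set.indicator {K | K₁ ≤ K}
        (fun K => Cn * recordsBudget (Δ * Real.exp (C.κ₁ * (D : ℝ)) * birthMass C) C.κ₁ V Λ ηplus jstar K)) := by
  have hθz : 0 ≤ zoneRate Kz p σ ε' θ := zoneRate_nonneg hKz hp h0 h1σ hθ.le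
  have hΛ0' : 0 ≤ Λ' * Real.exp ε' := mul_nonneg hΛ0 (Real.exp_pos ε').le
  have hΔ0 : 0 ≤ Δ := zero_le_one.trans hΔ
  refine relWeightBound_lateMergersG_of_irThresholdH sh h hμ₀ hθz Cell hV hΛ hcell Dcap Ncap jstar hj hc hfrac D hΔ hA
    hA' hCn R g β' h27 h29 hR hx1 hir hP hηplus hr hΛ0' (by simpa [mul_assoc] using h1)
    (by simpa [mul_assoc] using hx) y hy0 ?_ str hinj hstr hF hF'
  intro K hK j hjK z hz G hG
  rcases hlabZS K hK j hjK z hz G hG with h0' | ⟨G', hcG, hfG, hinjB, hKr, hsh, hy⟩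
  · exact Or.inl h0'
  · exact Or.inr ⟨G', hcG, hfG, hKr, hsh,
      hy.trans (priceZS_le_priceG sh hKz hp h0 h1σ hε hθ hΛ0 hΔ0 (g K) hcG hfG hinjB)⟩

/-- **ITS HORIZON-`0` SOCKET DRESS** (`ConsistentT`, `K < reach`): `HistoryZoneSurchargeTagged.relWeightBound_lateMergersZS0_of_irThreshold`
TOKEN FOR TOKEN except `hir` over `irThresholdZH C Kz p σ ε θ L r β₀ 0`. [folklore] -/
theorem relWeightBound_lateMergersZS0_of_irThresholdH (sh : ε → PEv) {C : T4PrintedShapeBanking.Consts} {L r : ℕ}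
    {β₀ : ℝ} (h : ThresholdOK C L r β₀) (hμ₀ : 0 < C.μ)
    {Kz p σ ε' θ : ℝ} (hKz : 1 ≤ Kz) (hp : 0 ≤ p) (h0 : 0 < σ) (h1σ : σ < 1) (hε : 0 < ε') (hθ : 0 < θ)
    (Cell : ℕ → ℕ → Finset γ) {V Λ : ℝ} (hV : 0 ≤ V) (hΛ : 0 < Λ)
    (hcell : ∀ K a, ((Cell K a).card : ℝ) ≤ V * Λ ^ a) (Dcap Ncap : ℕ → ℕ)
    (jstar : ℕ → ℕ) (hj : ∀ K, jstar K ≤ K) {c : ℝ} (hc : 0 < c)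
    (hfrac : ∀ K : ℕ, c * K ≤ ((K - jstar K : ℕ) : ℝ)) {Δ : ℝ} (hΔ : 1 ≤ Δ)
    (hA : Regeneration l₀ π T A Bad' dead F Rf nlow nup Cn K₀)
    (hA' : Regeneration l₀ π T A' Bad' dead' F' Rf' mlow mup Cn K₀) (hCn : 0 ≤ Cn)
    (R : ℕ → ℕ → ℕ) (g : ℕ → ℕ → ℝ) (β' : ℕ → ℝ)
    (h27 : ∀ K, K₀ ≤ K → B14.FlowIneq27 (g K) (β' K) β₀ C.p₀ K)
    (h29 : ∀ K, K₀ ≤ K → B14FlowStep.FlowIneq29 (R K) (g K) L (β' K) β₀ K)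
    (hR : ∀ K, K₀ ≤ K → ∀ s, s ≤ K → B14.IsRj L r (g K s) (R K s))
    (hx1 : ∀ K, K₀ ≤ K → ∀ s, s ≤ K → 1 ≤ Real.log ((g K s) ^ 2)⁻¹)
    (hir : ∀ K, K₀ ≤ K → irThresholdZH C Kz p σ ε' θ L r β₀ 0 ≤ Real.log ((g K K) ^ 2)⁻¹)
    (hP : ∀ K s, 0 ≤ p0Profile C.A₀ C.p₀ (g K s))
    {ηplus : ℝ} (hηplus : 0 ≤ ηplus) (hr : Λ * Real.exp (ηplus - C.κ₁) < 1)
    {Λ' : ℝ} (hΛ0 : 0 ≤ Λ') (h1 : Λ' * Real.exp ε' * Real.exp (-C.κ₁) * Real.exp ηplus < 1)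
    (hx : (Real.exp (-C.E₀) + Real.exp (-C.E₀) * birthMass C *
          (Λ' * Real.exp ε' * Real.exp (-C.κ₁) / (1 - Λ' * Real.exp ε' * Real.exp (-C.κ₁) * Real.exp ηplus))) *
          Real.exp ηplus ≤
        Real.exp ηplus - 1)
    (y : ℕ → ℕ → γ → Gen PEv → ℝ)
    (hy0 : ∀ K, ∀ j ≤ K, ∀ z ∈ Cell K (K - j), ∀ G ∈ canonFam Dcap Ncap K j, 0 ≤ y K j z G)
    (hlabZS0 : ∀ K, K₀ ≤ K → ∀ j ≤ K, ∀ z ∈ Cell K (K - j), ∀ G ∈ canonFam Dcap Ncap K j,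
      y K j z G ≤ 0 ∨ ∃ G' : Gen ε, ConsistentT sh C K (R K) G' ∧ FreshT G' ∧ Set.InjOn sh ↑(births G') ∧
        K < G'.reach (dictWT sh (R K) C.n₁) ∧ relabel (shape ∘ sh) G' = G ∧
        y K j z G ≤ Δ * (Kz ^ (merges G').card *
          (∏ e ∈ merges G', Crowding.Q (wcntS sh G') σ (sh e).step ^ p) *
          Λ' ^ partnerAges (PEv.step ∘ sh) G' * (Real.exp (-credits (credit C (g K) ∘ sh) G') *
            Real.exp (lifeCost (padW (dictWT sh (R K) C.n₁) 0) (costT sh C K (R K)) G'))))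
    (str : ℕ → κ → Finset (BSlot γ PEv))
    (hinj : ∀ K t, |t| ≤ l₀ → K₀ ≤ K → Set.InjOn (str K) (Bad' K t))
    (hstr : ∀ K t, |t| ≤ l₀ → K₀ ≤ K → ∀ c ∈ Bad' K t,
      str K c ⊆ bliveSlots Cell (canonFam Dcap Ncap) K ∧
        ∃ o ∈ boldSlots Cell (canonFam Dcap Ncap) jstar K, o ∈ str K c)
    (hF : ∀ K t, |t| ≤ l₀ → K₀ ≤ K → ∀ c ∈ Bad' K t, F K c * Rf K c ≤ famWeight (bslotPrice (y K)) (str K c))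
    (hF' : ∀ K t, |t| ≤ l₀ → K₀ ≤ K → ∀ c ∈ Bad' K t, F' K c * Rf' K c ≤ famWeight (bslotPrice (y K)) (str K c)) :
    ∃ K₁, K₀ ≤ K₁ ∧ RelWeightBound l₀ T A A' (fun K t => if K₁ ≤ K then badOfClass π T Bad' K t else ∅)
      (Set.indicator {K | K₁ ≤ K}
        (fun K => Cn * recordsBudget (Δ * Real.exp (C.κ₁ * ((0 : ℕ) : ℝ)) * birthMass C) C.κ₁ V Λ ηplus jstar K)) := by
  refine relWeightBound_lateMergersZS_of_irThresholdH sh h hμ₀ hKz hp h0 h1σ hε hθ Cell hV hΛ hcell Dcap Ncap jstar hj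
    hc hfrac 0 hΔ hA hA' hCn R g β' h27 h29 hR hx1 hir hP hηplus hr hΛ0 h1 hx y hy0 ?_ str hinj hstr hF hF'
  intro K hK j hjK z hz G hG
  rcases hlabZS0 K hK j hjK z hz G hG with h0' | ⟨G', hcT, hfG, hinjB, hKr, hsh, hy⟩
  · exact Or.inl h0'
  · exact Or.inr ⟨G', consistentTH_zero_iff.2 hcT, hfG, hinjB, by simpa using hKr, hsh, hy⟩

/-- **THE FLAT FORM (v1) OVER THE SHAPE-FREE THRESHOLD**: `HistoryZoneSurcharge.relWeightBound_lateMergersZ_of_irThreshold`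
(multiplicity on `gmap sh G′`, `Set.InjOn sh ↑G′.events`, horizon `0` — the binder list `HistorySocketZTH`'s END consumes)
TOKEN FOR TOKEN except `hir` over `irThresholdZH C Kz p σ ε θ L r β₀ 0`. [folklore] -/
theorem relWeightBound_lateMergersZ_of_irThresholdH (sh : ε → PEv) {C : T4PrintedShapeBanking.Consts} {L r : ℕ}
    {β₀ : ℝ} (h : ThresholdOK C L r β₀) (hμ₀ : 0 < C.μ)
    {Kz p σ ε' θ : ℝ} (hKz : 1 ≤ Kz) (hp : 0 ≤ p) (h0 : 0 < σ) (h1σ : σ < 1) (hε : 0 < ε') (hθ : 0 < θ)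
    (Cell : ℕ → ℕ → Finset γ) {V Λ : ℝ} (hV : 0 ≤ V) (hΛ : 0 < Λ)
    (hcell : ∀ K a, ((Cell K a).card : ℝ) ≤ V * Λ ^ a) (Dcap Ncap : ℕ → ℕ)
    (jstar : ℕ → ℕ) (hj : ∀ K, jstar K ≤ K) {c : ℝ} (hc : 0 < c)
    (hfrac : ∀ K : ℕ, c * K ≤ ((K - jstar K : ℕ) : ℝ)) {Δ : ℝ} (hΔ : 1 ≤ Δ)
    (hA : Regeneration l₀ π T A Bad' dead F Rf nlow nup Cn K₀)
    (hA' : Regeneration l₀ π T A' Bad' dead' F' Rf' mlow mup Cn K₀) (hCn : 0 ≤ Cn)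
    (R : ℕ → ℕ → ℕ) (g : ℕ → ℕ → ℝ) (β' : ℕ → ℝ)
    (h27 : ∀ K, K₀ ≤ K → B14.FlowIneq27 (g K) (β' K) β₀ C.p₀ K)
    (h29 : ∀ K, K₀ ≤ K → B14FlowStep.FlowIneq29 (R K) (g K) L (β' K) β₀ K)
    (hR : ∀ K, K₀ ≤ K → ∀ s, s ≤ K → B14.IsRj L r (g K s) (R K s))
    (hx1 : ∀ K, K₀ ≤ K → ∀ s, s ≤ K → 1 ≤ Real.log ((g K s) ^ 2)⁻¹)
    (hir : ∀ K, K₀ ≤ K → irThresholdZH C Kz p σ ε' θ L r β₀ 0 ≤ Real.log ((g K K) ^ 2)⁻¹)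
    (hP : ∀ K s, 0 ≤ p0Profile C.A₀ C.p₀ (g K s))
    {ηplus : ℝ} (hηplus : 0 ≤ ηplus) (hr : Λ * Real.exp (ηplus - C.κ₁) < 1)
    {Λ' : ℝ} (hΛ0 : 0 ≤ Λ') (h1 : Λ' * Real.exp ε' * Real.exp (-C.κ₁) * Real.exp ηplus < 1)
    (hx : (Real.exp (-C.E₀) + Real.exp (-C.E₀) * birthMass C *
          (Λ' * Real.exp ε' * Real.exp (-C.κ₁) / (1 - Λ' * Real.exp ε' * Real.exp (-C.κ₁) * Real.exp ηplus))) *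
          Real.exp ηplus ≤
        Real.exp ηplus - 1)
    (y : ℕ → ℕ → γ → Gen PEv → ℝ)
    (hy0 : ∀ K, ∀ j ≤ K, ∀ z ∈ Cell K (K - j), ∀ G ∈ canonFam Dcap Ncap K j, 0 ≤ y K j z G)
    (hlabZTH : ∀ K, K₀ ≤ K → ∀ j ≤ K, ∀ z ∈ Cell K (K - j), ∀ G ∈ canonFam Dcap Ncap K j,
      y K j z G ≤ 0 ∨ ∃ G' : Gen ε, ConsistentT sh C K (R K) G' ∧ FreshT G' ∧ Set.InjOn sh ↑G'.events ∧
        K < G'.reach (dictWT sh (R K) C.n₁) ∧ relabel (shape ∘ sh) G' = G ∧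
        y K j z G ≤ Δ * (Kz ^ (merges (gmap sh G')).card *
          (∏ e ∈ merges (gmap sh G'), Crowding.Q (wcnt (gmap sh G')) σ e.step ^ p) *
          Λ' ^ partnerAges PEv.step (gmap sh G') * (Real.exp (-credits (credit C (g K) ∘ sh) G') *
            Real.exp (lifeCost (padW (dictWT sh (R K) C.n₁) 0) (costT sh C K (R K)) G'))))
    (str : ℕ → κ → Finset (BSlot γ PEv))
    (hinj : ∀ K t, |t| ≤ l₀ → K₀ ≤ K → Set.InjOn (str K) (Bad' K t))
    (hstr : ∀ K t, |t| ≤ l₀ → K₀ ≤ K → ∀ c ∈ Bad' K t,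
      str K c ⊆ bliveSlots Cell (canonFam Dcap Ncap) K ∧
        ∃ o ∈ boldSlots Cell (canonFam Dcap Ncap) jstar K, o ∈ str K c)
    (hF : ∀ K t, |t| ≤ l₀ → K₀ ≤ K → ∀ c ∈ Bad' K t, F K c * Rf K c ≤ famWeight (bslotPrice (y K)) (str K c))
    (hF' : ∀ K t, |t| ≤ l₀ → K₀ ≤ K → ∀ c ∈ Bad' K t, F' K c * Rf' K c ≤ famWeight (bslotPrice (y K)) (str K c)) :
    ∃ K₁, K₀ ≤ K₁ ∧ RelWeightBound l₀ T A A' (fun K t => if K₁ ≤ K then badOfClass π T Bad' K t else ∅)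
      (Set.indicator {K | K₁ ≤ K}
        (fun K => Cn * recordsBudget (Δ * Real.exp (C.κ₁ * ((0 : ℕ) : ℝ)) * birthMass C) C.κ₁ V Λ ηplus jstar K)) := by
  have hθz : 0 ≤ zoneRate Kz p σ ε' θ := zoneRate_nonneg hKz hp h0 h1σ hθ.le
  have hΛ0' : 0 ≤ Λ' * Real.exp ε' := mul_nonneg hΛ0 (Real.exp_pos ε').le
  have hΔ0 : 0 ≤ Δ := zero_le_one.trans hΔ
  refine relWeightBound_lateMergersG_of_irThresholdH sh h hμ₀ hθz Cell hV hΛ hcell Dcap Ncap jstar hj hc hfrac 0 hΔ hA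
    hA' hCn R g β' h27 h29 hR hx1 hir hP hηplus hr hΛ0' (by simpa [mul_assoc] using h1)
    (by simpa [mul_assoc] using hx) y hy0 ?_ str hinj hstr hF hF'
  intro K hK j hjK z hz G hG
  rcases hlabZTH K hK j hjK z hz G hG with h0' | ⟨G', hcT, hfG, hinjG, hKr, hsh, hy⟩
  · exact Or.inl h0'
  · exact Or.inr ⟨G', consistentTH_zero_iff.2 hcT, hfG, by simpa using hKr, hsh,
      hy.trans (priceZ_le_priceG sh hKz hp h0 h1σ hε hθ hΛ0 hΔ0 hcT hfG hinjG _ (by positivity))⟩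

end EndToEnd

end

end Summit.QuantumFields.BalabanUV.T4Continuum.HistoryZoneSurchargeShapeFree
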